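import Summits.QuantumFields.BalabanUV.Beta.EriceRemainderEnclosureHistoryAutonomyThresholdWitness

/-!
# EriceRemainderEnclosureHistoryAutonomyThresholdWitnessExact — (E44c) (E38c)'s MARKOV TENT FLOW HAS EXACTLY TWO BOX SOLUTIONS: for
# `y ∈ [9∕10, 1[` the box solutions of the flow of `u ↦ 2 + max(3∕y² − 3 − 3(1+y)∕y²·|√3·u₀ − y|, 0)` from the pin `1` in ]0,1] are node U2's
# slow branch `hSlow` and (E38c)'s fast branch `hF_y`, and NOTHING ELSE — at scale 1 the implicit step equation factors as
# `(s − 1)(s − y)(s + ys + y) = 0` in `s = √3·h(1)`, afterwards asymptotic freedom keeps every solution left of the tent's support; so the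
# solution set is the two-point set `{hSlow, hF_y}` and (E44a)'s classifying numbers are `{0, 3∕y² − 3}`: above the threshold `3√3` the
# «compact line set» of (E44b) can be DISCONNECTED (here) as well as an interval ((E45a)), with the same endpoints

Cell `pub-balaban`, β-function sub-cell, BINDER row D4 «RemainderConst leaves for Bałaban's split» (`HOME/BINDER-OWNERS.md`; owner
lineage `b2b-balaban-beta-an4`; this file by co-owner #2 lineage `b2b-balaban-beta-d4-p2`, generation 41), β-FLOW TEAM duty (1),
FREEZE (0) honoured (def-free; (E38c) `…HistoryAutonomyThresholdWitness` BY NAME — its tent lemmas, `memFlow_hSlow_tentφ`, `memFlow_hF_tentφ`,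
`hSlow_ne_hF`; node U2's `Sharpness.hSlow`).

HONEST FRAMING (page 1, verbatim and binding).  *"Discharging BetaPertH makes Bałaban's UV stability UNCONDITIONAL — a real
constructive-QFT result; it is NOT the continuum limit and NOT the Clay problem."*  THIS FILE DISCHARGES NOTHING OF THE KIND.  Elementary
real algebra about an EXPLICIT TOY FAMILY; nothing of Bałaban's (1.22) asserted.  Row D4 class UNCHANGED (critical-path width 0; instance
0∕1; D4 DISCHARGE NO DATE).  HONEST DEPENDENCY: continuum YM on T⁴ ⇐ BetaPertH ∧ nine spine estimates (0/9 proved); BetaPertH ⇐ (D1) ∧ (D4) ∧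
CAP+tail; G-an2-4 gates asym, D1 and NE2/3/4.

WHAT IS PROVED ([folklore]; 0 `def`, 0 sorry).  `eq_of_one_div_sq_eq`, `cubic_factor` (the scale-1 identity), **`first_scale_dichotomy`**
(`1∕h(1)² ∈ {3, 3∕y²}`), `radicandF_succ`, `succ_step_eq_add_two` (from scale 2 on the increment is the floor `2`), **`eq_hSlow_or_eq_hF_of_memFlow`**,
**`memFlow_tent_iff`**, **`solutionSet_eq_pair`**, `solutionSet_ncard` (`= 2`), `tendsto_disc_hF_hSlow`, **`image_lim_disc_eq_pair`**
(`= {0, 3∕y² − 3}`).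
-/

noncomputable section
open Filter Topology Finset

namespace Summit.QuantumFields.BalabanUV.Beta.EriceRemainderEnclosureHistoryAutonomyThresholdWitnessExact

open Literature.MathematicalPhysics.QuantumFieldTheory.Balaban1983to89
open Literature.MathematicalPhysics.QuantumFieldTheory.Balaban1983to89.T4BetaStationary
open Literature.MathematicalPhysics.QuantumFieldTheory.Balaban1983to89.T4BetaFlowWellPosed
open Literature.MathematicalPhysics.QuantumFieldTheory.Balaban1983to89.T4BetaFlowWellPosed.Sharpness
  (hSlow ySlow hSlow_zero seqBox_hSlow ySlow_pos one_div_one_div_sqrt_sq)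
open Summit.QuantumFields.BalabanUV.Beta.EriceRemainderEnclosureHistoryAutonomyThresholdWitness

variable {y : ℝ}

/-! ## §1 Scale 1: the implicit step equation has exactly the two roots `√3·h(1) ∈ {1, y}` -/

/-- Positive reals with equal inverse squares are equal. [folklore] -/
theorem eq_of_one_div_sq_eq {x z : ℝ} (hx : 0 < x) (hz : 0 < z) (h : 1 / x ^ 2 = 1 / z ^ 2) : x = z := by
  have h2 : x ^ 2 = z ^ 2 := by
    have := congrArg (fun t : ℝ => 1 / t) h
    simpa only [one_div_one_div] using this
  exact (pow_left_inj₀ hx.le hz.le two_ne_zero).1 h2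

/-- THE SCALE-1 IDENTITY: if `3·y² = (3 − 3(1+y)(s − y))·s²` then `(s − 1)(s − y)(s + ys + y) = 0`. [folklore] -/
theorem cubic_factor {s : ℝ} (e : 3 * y ^ 2 = (3 - 3 * (1 + y) * (s - y)) * s ^ 2) :
    (s - 1) * ((s - y) * (s + y * s + y)) = 0 := by
  linear_combination (1 / 3 : ℝ) * e

/-- **THE FIRST-SCALE DICHOTOMY**: a box solution of the tent flow from the pin `1` (`0 < y ≤ 1`) has `1∕h(1)² = 3` or `1∕h(1)² = 3∕y²`.
The floor and the height put `s = √3·h(1)` in `[y, 1]`, where the tent is `3(1+y)(1 − s)∕y²` and the step equation `3∕s² = 3 + tent` becomes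
`(s − 1)(s − y)(s + ys + y) = 0`. [folklore] -/
theorem first_scale_dichotomy (hy0 : 0 < y) (hy1 : y ≤ 1) {h : ℕ → ℝ} (hh : SeqBox 1 h)
    (hf : MemFlow (fun u => (fun x : ℝ => (2 : ℝ) + max (3 / y ^ 2 - 3 - 3 * (1 + y) / y ^ 2 * |Real.sqrt 3 * x - y|) 0) (u 0)) 1 h) :
    1 / h 1 ^ 2 = 3 ∨ 1 / h 1 ^ 2 = 3 / y ^ 2 := by
  have h1pos : 0 < h 1 := (hh 1).1
  have h0 : 1 / h 0 ^ 2 = 1 := by rw [hf.1]; norm_num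
  have heq : 1 / h 1 ^ 2 = 1 + (2 + max (3 / y ^ 2 - 3 - 3 * (1 + y) / y ^ 2 * |Real.sqrt 3 * h 1 - y|) 0) := by
    have := hf.2 0; simp only [zero_add, add_zero] at this; rw [h0] at this; exact this
  set s : ℝ := Real.sqrt 3 * h 1 with hs
  have hs0 : 0 < s := by positivity
  have hs2 : s ^ 2 = 3 * h 1 ^ 2 := by rw [hs, mul_pow, Real.sq_sqrt (by norm_num : (0 : ℝ) ≤ 3)]
  have ha : 1 / h 1 ^ 2 = 3 / s ^ 2 := by rw [hs2]; field_simp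
  -- the window `y ≤ s ≤ 1`
  have hmax0 : 0 ≤ max (3 / y ^ 2 - 3 - 3 * (1 + y) / y ^ 2 * |s - y|) 0 := le_max_right _ _
  have hmaxT : max (3 / y ^ 2 - 3 - 3 * (1 + y) / y ^ 2 * |s - y|) 0 ≤ 3 / y ^ 2 - 3 := by
    refine max_le ?_ (by linarith [three_le_three_div_sq hy0 hy1])
    have : 0 ≤ 3 * (1 + y) / y ^ 2 * |s - y| := by positivity
    linarith
  have ha3 : 3 ≤ 3 / s ^ 2 := by rw [← ha]; linarith
  have haT : 3 / s ^ 2 ≤ 3 / y ^ 2 := by rw [← ha]; linarith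
  have hs1 : s ≤ 1 := by
    by_contra hlt
    have : 3 / s ^ 2 < 3 := by
      rw [div_lt_iff₀ (by positivity)]; nlinarith
    linarith
  have hys : y ≤ s := by
    by_contra hlt
    have : 3 / y ^ 2 < 3 / s ^ 2 := div_lt_div_of_pos_left (by norm_num) (by positivity) (by nlinarith)
    linarith
  -- the tent value on the window and the polynomial identity
  rw [abs_of_nonneg (sub_nonneg.2 hys)] at heq
  have hnn : 0 ≤ 3 / y ^ 2 - 3 - 3 * (1 + y) / y ^ 2 * (s - y) := by
    have e : 3 / y ^ 2 - 3 - 3 * (1 + y) / y ^ 2 * (s - y) = 3 * (1 + y) * (1 - s) / y ^ 2 := by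
      field_simp
      ring
    rw [e]
    exact div_nonneg (by nlinarith) (by positivity)
  rw [max_eq_left hnn, ha] at heq
  have e2 : 3 / s ^ 2 * y ^ 2 = 3 - 3 * (1 + y) * (s - y) := by
    rw [heq]
    field_simp
    ring
  have e3 : 3 * y ^ 2 = (3 - 3 * (1 + y) * (s - y)) * s ^ 2 := by
    rw [← e2]
    field_simp
  have key := cubic_factor e3
  have hpos : 0 < s + y * s + y := by positivity
  rcases mul_eq_zero.1 key with h1 | h23
  · left
    rw [ha, sub_eq_zero.1 h1]; norm_num
  · rcases mul_eq_zero.1 h23 with h2 | h3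
    · right
      rw [ha, sub_eq_zero.1 h2]
    · exact absurd h3 hpos.ne'

/-! ## §2 From scale 2 on the tent is inactive; the two branches are the only solutions -/

/-- The fast branch's radicand at scale `k+1` is `3∕y² + 2k`. [folklore] -/
theorem radicandF_succ (y : ℝ) (k : ℕ) :
    1 + 2 * (((k + 1 : ℕ) : ℝ)) + (3 / y ^ 2 - 3) * min (((k + 1 : ℕ) : ℝ)) 1 = 3 / y ^ 2 + 2 * (k : ℝ) := by
  have hmin : min (((k + 1 : ℕ) : ℝ)) 1 = 1 := min_eq_right (by push_cast; linarith [(Nat.cast_nonneg k : (0 : ℝ) ≤ k)])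
  rw [hmin]; push_cast; ring

/-- FROM SCALE 2 ON THE INCREMENT IS THE FLOOR: for a box solution and `m ≥ 1`, `1∕h(m+1)² = 1∕h(m)² + 2` (`9∕10 ≤ y ≤ 1`): the recursion
variables are `≥ 5` there, so `√3·h(m+1) ≤ 2y − 1` lies left of the support. [folklore] -/
theorem succ_step_eq_add_two (hy0 : 0 < y) (hy9 : 9 / 10 ≤ y) (hy1 : y ≤ 1) {h : ℕ → ℝ} (hh : SeqBox 1 h)
    (hf : MemFlow (fun u => (fun x : ℝ => (2 : ℝ) + max (3 / y ^ 2 - 3 - 3 * (1 + y) / y ^ 2 * |Real.sqrt 3 * x - y|) 0) (u 0)) 1 h)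
    {m : ℕ} (hm : 1 ≤ m) : 1 / h (m + 1) ^ 2 = 1 / h m ^ 2 + 2 := by
  have hstep : ∀ n, 1 / h (n + 1) ^ 2
      = 1 / h n ^ 2 + (2 + max (3 / y ^ 2 - 3 - 3 * (1 + y) / y ^ 2 * |Real.sqrt 3 * h (n + 1) - y|) 0) := fun n => by
    have := hf.2 n; simp only [add_zero] at this; exact this
  -- `1∕h(n)² ≥ 3` for `n ≥ 1`
  have hge3 : ∀ n, 1 ≤ n → 3 ≤ 1 / h n ^ 2 := by
    intro n hn
    induction n, hn using Nat.le_induction with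
    | base =>
      rcases first_scale_dichotomy hy0 hy1 hh hf with e | e
      · rw [e]
      · rw [e]; exact three_le_three_div_sq hy0 hy1
    | succ n _ ih => rw [hstep n]; linarith [le_max_right (3 / y ^ 2 - 3 - 3 * (1 + y) / y ^ 2 * |Real.sqrt 3 * h (n + 1) - y|) 0]
  have h5 : 5 ≤ 1 / h (m + 1) ^ 2 := by
    rw [hstep m]
    linarith [hge3 m hm, le_max_right (3 / y ^ 2 - 3 - 3 * (1 + y) / y ^ 2 * |Real.sqrt 3 * h (m + 1) - y|) 0]
  have hx : Real.sqrt 3 * h (m + 1) ≤ 2 * y - 1 := by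
    have e : h (m + 1) = 1 / Real.sqrt (1 / h (m + 1) ^ 2) := (one_div_sqrt_one_div_sq (hh (m + 1)).1).symm
    rw [e]
    exact sqrt3_div_sqrt_le h5 hy9
  rw [hstep m, tent_eq_zero_of_le hy0 hx, add_zero]

/-- **EVERY BOX SOLUTION IS ONE OF THE TWO BRANCHES**: `h = hSlow` or `h = hF_y` (`9∕10 ≤ y ≤ 1`). [folklore] -/
theorem eq_hSlow_or_eq_hF_of_memFlow (hy0 : 0 < y) (hy9 : 9 / 10 ≤ y) (hy1 : y ≤ 1) {h : ℕ → ℝ} (hh : SeqBox 1 h)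
    (hf : MemFlow (fun u => (fun x : ℝ => (2 : ℝ) + max (3 / y ^ 2 - 3 - 3 * (1 + y) / y ^ 2 * |Real.sqrt 3 * x - y|) 0) (u 0)) 1 h) :
    h = hSlow ∨ h = (fun m : ℕ => (1 : ℝ) / Real.sqrt (1 + 2 * (m : ℝ) + (3 / y ^ 2 - 3) * min (m : ℝ) 1)) := by
  have hform : ∀ m : ℕ, 1 / h (m + 1) ^ 2 = 1 / h 1 ^ 2 + 2 * (m : ℝ) := by
    intro m
    induction m with
    | zero => simp
    | succ m ih => rw [succ_step_eq_add_two hy0 hy9 hy1 hh hf (by omega : 1 ≤ m + 1), ih]; push_cast; ring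
  rcases first_scale_dichotomy hy0 hy1 hh hf with e | e
  · left
    funext m
    cases m with
    | zero => rw [hf.1, hSlow_zero]
    | succ m =>
      refine eq_of_one_div_sq_eq (hh (m + 1)).1 (seqBox_hSlow (m + 1)).1 ?_
      rw [hform m, e, one_div_hSlow_sq]; push_cast; ring
  · right
    funext m
    cases m with
    | zero => rw [hf.1]; simp
    | succ m =>
      refine eq_of_one_div_sq_eq (hh (m + 1)).1 (seqBox_hF hy0 hy1 (m + 1)).1 ?_
      rw [hform m, e, radicandF_succ, one_div_one_div_sqrt_sq (by linarith [three_le_radicand hy0 hy1 m])]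

/-- **THE TENT FLOW'S BOX SOLUTIONS, EXACTLY**: `SeqBox 1 h ∧ MemFlow φ_y 1 h ⟺ h = hSlow ∨ h = hF_y` (`9∕10 ≤ y ≤ 1`). [folklore] -/
theorem memFlow_tent_iff (hy0 : 0 < y) (hy9 : 9 / 10 ≤ y) (hy1 : y ≤ 1) (h : ℕ → ℝ) :
    (SeqBox 1 h ∧ MemFlow (fun u => (fun x : ℝ => (2 : ℝ) + max (3 / y ^ 2 - 3 - 3 * (1 + y) / y ^ 2 * |Real.sqrt 3 * x - y|) 0) (u 0)) 1 h)
      ↔ h = hSlow ∨ h = (fun m : ℕ => (1 : ℝ) / Real.sqrt (1 + 2 * (m : ℝ) + (3 / y ^ 2 - 3) * min (m : ℝ) 1)) := by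
  refine ⟨fun hh => eq_hSlow_or_eq_hF_of_memFlow hy0 hy9 hy1 hh.1 hh.2, ?_⟩
  rintro (rfl | rfl)
  · exact ⟨seqBox_hSlow, memFlow_hSlow_tentφ hy0 hy9 hy1⟩
  · exact ⟨seqBox_hF hy0 hy1, memFlow_hF_tentφ hy0 hy9 hy1⟩

/-- **THE SOLUTION SET IS THE TWO-POINT SET `{hSlow, hF_y}`.** [folklore] -/
theorem solutionSet_eq_pair (hy0 : 0 < y) (hy9 : 9 / 10 ≤ y) (hy1 : y ≤ 1) :
    {h : ℕ → ℝ | SeqBox 1 h ∧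
        MemFlow (fun u => (fun x : ℝ => (2 : ℝ) + max (3 / y ^ 2 - 3 - 3 * (1 + y) / y ^ 2 * |Real.sqrt 3 * x - y|) 0) (u 0)) 1 h}
      = {hSlow, (fun m : ℕ => (1 : ℝ) / Real.sqrt (1 + 2 * (m : ℝ) + (3 / y ^ 2 - 3) * min (m : ℝ) 1))} := by
  ext h
  rw [Set.mem_setOf_eq, memFlow_tent_iff hy0 hy9 hy1 h]
  simp only [Set.mem_insert_iff, Set.mem_singleton_iff]

/-- … with exactly TWO elements for `y < 1`. [folklore] -/
theorem solutionSet_ncard (hy0 : 0 < y) (hy9 : 9 / 10 ≤ y) (hy1 : y < 1) :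
    {h : ℕ → ℝ | SeqBox 1 h ∧
        MemFlow (fun u => (fun x : ℝ => (2 : ℝ) + max (3 / y ^ 2 - 3 - 3 * (1 + y) / y ^ 2 * |Real.sqrt 3 * x - y|) 0) (u 0)) 1 h}.ncard
      = 2 := by
  rw [solutionSet_eq_pair hy0 hy9 hy1.le]
  exact Set.ncard_pair (hSlow_ne_hF hy0 hy1)

/-! ## §3 The classifying numbers: `{0, 3∕y² − 3}` -/

/-- The discrepancy of the fast against the slow branch is `3∕y² − 3` from scale 1 on, hence tends to it. [folklore] -/
theorem tendsto_disc_hF_hSlow (hy0 : 0 < y) (hy1 : y ≤ 1) :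
    Tendsto (fun m : ℕ => 1 / (1 / Real.sqrt (1 + 2 * (m : ℝ) + (3 / y ^ 2 - 3) * min (m : ℝ) 1)) ^ 2 - 1 / hSlow m ^ 2)
      atTop (𝓝 (3 / y ^ 2 - 3)) := by
  refine tendsto_const_nhds.congr' (eventually_atTop.2 ⟨1, fun m hm => ?_⟩)
  obtain ⟨k, rfl⟩ := Nat.exists_eq_add_of_le' hm
  beta_reduce
  rw [radicandF_succ, one_div_one_div_sqrt_sq (by linarith [three_le_radicand hy0 hy1 k]), one_div_hSlow_sq]
  push_cast
  ring

/-- **THE CLASSIFYING SET IS `{0, 3∕y² − 3}`**: against `hSlow`, (E44a)'s asymptotic discrepancies of the box solutions take exactly two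
values (`9∕10 ≤ y ≤ 1`) — the endpoints of (E45a)'s interval `[0, 3∕y² − 3]`. [folklore] -/
theorem image_lim_disc_eq_pair (hy0 : 0 < y) (hy9 : 9 / 10 ≤ y) (hy1 : y ≤ 1) :
    (fun h : ℕ → ℝ => limUnder atTop (fun m => 1 / h m ^ 2 - 1 / hSlow m ^ 2)) ''
      {h : ℕ → ℝ | SeqBox 1 h ∧
        MemFlow (fun u => (fun x : ℝ => (2 : ℝ) + max (3 / y ^ 2 - 3 - 3 * (1 + y) / y ^ 2 * |Real.sqrt 3 * x - y|) 0) (u 0)) 1 h}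
      = {0, 3 / y ^ 2 - 3} := by
  rw [solutionSet_eq_pair hy0 hy9 hy1, Set.image_pair]
  have h1 : limUnder atTop (fun m : ℕ => 1 / hSlow m ^ 2 - 1 / hSlow m ^ 2) = 0 := by
    simp only [sub_self]; exact tendsto_const_nhds.limUnder_eq
  beta_reduce
  rw [h1, (tendsto_disc_hF_hSlow hy0 hy1).limUnder_eq]

end Summit.QuantumFields.BalabanUV.Beta.EriceRemainderEnclosureHistoryAutonomyThresholdWitnessExact

end
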